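import Summits.AnomalousDissipation.AnomalousDissipation.Theorems.SteadyCoherentFractionRootsPlanarBeyondFiniteModesRefutation
import Summits.AnomalousDissipation.AnomalousDissipation.Theses.CoherentFraction
import Literature.MeasureTheory.Measure.DiracExtremePoints

/-!
# `ExtremeClimatesPlanarBeyondFiniteModes` (stmt-AnomalousDissipation-27871, route CoherentFraction, aside r9) is FALSE

The item asks that every EXTREME point of the tame stationary Euler+drift climate class (probability measures on the energy
space with a.e. enstrophy `≤ R` and the cylindrical stationary identity with drift `m`) which is not the Dirac mass of a
finite-mode state be carried by planar states.  A Dirac mass `δ_v` is an extreme point of ANY class of probability measures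
containing it (`MeasureTheory.Measure.DiracExtreme.dirac_mem_extremePoints`, Literature/MeasureTheory/Measure/DiracExtremePoints —
Conway V.8.4 / Exercise V.8.3: if `δ_v = a•ρ₁ + b•ρ₂` with `a, b > 0` then `ρ₁({v}ᶜ) = 0`, so `ρ₁ = δ_v`), and
`δ_v = δ_{v'}` forces `v = v'` (measurable singletons); hence the item implies the cylindrical-root statement
`SteadyCoherentFraction.RootsPlanarBeyondFiniteModes` (the reduction is inlined in `not_extremeClimatesPlanarBeyondFiniteModes`),
which is false by the crossed-shear / reciprocal-shear root of infinite Fourier type (`not_rootsPlanarBeyondFiniteModes`).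
Class: refuted-SUBSTANTIVE (same witness as `TameEulerClimatesPlanar` 27427 and `RootsPlanarBeyondFiniteModes` 28530; the
decomp-ad cell had already recorded 27871 ≡ TEP modulo `TravellingWaveTransfer` + `ExtremeClimateReduction`, lens-4 g18 erratum,
STATUS 2026-08-30T19:55:48Z).  Consequence of record: `TravellingWaveTransfer` (28076) `= (27871 → 27870)` holds vacuously.
-/

noncomputable section

-- `Summit.<Summit>.<Problem>` is the tree's mandated summit-side namespace (CONVENTIONS §2); for this
-- single-conjunct summit the two segments coincide, so the duplicate is deliberate.
set_option linter.dupNamespace false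

namespace Summit.AnomalousDissipation.AnomalousDissipation.Theorems.CrossedShearRoot

open Real MeasureTheory
open scoped InnerProductSpace ENNReal
open Literature.Analysis.FunctionSpaces Literature.Analysis.FunctionSpaces.Torus Literature.Analysis.FluidPDE

/-- **KILL: `ExtremeClimatesPlanarBeyondFiniteModes` (stmt-AnomalousDissipation-27871, route CoherentFraction, aside r9) is FALSE.**
Refutes `CoherentFraction.ExtremeClimatesPlanarBeyondFiniteModes` [refuted-substantive]: «extreme non-finite-Dirac tame stationary
climates are carried by planar states». WITNESS: the Dirac climate `δ_W` at the crossed-shear / reciprocal-shear root `W`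
(`A = 1`, `ε = 1`, `1/r = 1 + ½cos 2πx₂`, drift `m = c_K e₁`, `c_K = −1/(4π)`, `R = ‖∇W‖²`): `δ_W` is extreme (Dirac masses are
extreme among probability measures), `W` has infinite Fourier type (`not_isFiniteType`) so `δ_W` is no finite-mode Dirac, and the
translation defect of `W` is `≥ c_K²/16 > 0` in every lattice direction (`defect_state_ge`), so `δ_W`-a.e. planarity fails.
NO CHEAP REPAIR: the only repairs that exclude the witness are «finite Fourier type» (= the separate item `FiniteModeRootsPlanar`
27870 / `FiniteTypeClimatesPlanar` 28073, untouched) or genuinely non-Dirac extreme climates (no statement of the route isolates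
them; the laminar-proximity / small-enstrophy side conditions fail on the same one-parameter family, census E31/E28b) — the item is
TEP 27427 in costume (lens-4 g18 erratum) and dies with it. Barrier-candidate: «reciprocal-shear modulation» (already of record).
[folklore] -/
theorem not_extremeClimatesPlanarBeyondFiniteModes :
    ¬ Summit.AnomalousDissipation.AnomalousDissipation.Theses.CoherentFraction.ExtremeClimatesPlanarBeyondFiniteModes := by
  intro h
  -- reduction to the cylindrical-root statement `RootsPlanarBeyondFiniteModes` (28530): specialise the extreme climate to `δ_v`
  refine not_rootsPlanarBeyondFiniteModes fun m R v hfin hR hstat => ?_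
  -- singletons of the (metrisable, Borel) energy space are measurable
  haveI : MeasurableSingletonClass ↥(Literature.Analysis.FunctionSpaces.Torus.energySpace (Fin 3)) :=
    ⟨fun _ => isClosed_singleton.measurableSet⟩
  have hae := h m R (MeasureTheory.Measure.dirac v)
    (MeasureTheory.Measure.DiracExtreme.dirac_mem_extremePoints (fun ρ hρ => hρ.1) ⟨inferInstance,
      by rw [MeasureTheory.ae_dirac_eq]; exact Filter.eventually_pure.mpr hR,
      fun Φ => by rw [MeasureTheory.integral_dirac]; exact hstat Φ⟩)
    (by
      rintro ⟨v', hfin', hvv'⟩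
      obtain rfl := MeasureTheory.dirac_eq_dirac_iff.1 hvv'
      exact hfin hfin')
  rw [MeasureTheory.ae_dirac_eq] at hae
  exact Filter.eventually_pure.mp hae

end Summit.AnomalousDissipation.AnomalousDissipation.Theorems.CrossedShearRoot

end
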